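import Literature.MathematicalPhysics.QuantumLattice.FermiRG.BGM2006Sec2AnisoSupport
import Literature.MathematicalPhysics.QuantumLattice.FermiRG.BGM2006Sec2DerivativeBounds
import Literature.MathematicalPhysics.QuantumLattice.FermiRG.BGM2006Sec2ShellLineBounds
import Literature.MathematicalPhysics.QuantumLattice.FermiRG.BGM2006Sec2TwoScaleLeibniz
import HarnessLib

/-!
# Benfatto–Giuliani–Mastropietro 2006, §2.5, proof of Lemma 2.2: the tangential budget (2.53)–(2.55)
of the anisotropic sector integrand `F_{h,ω}/D_{h-1}`

Companion proof file of `BGM2006Sec2Setup.lean` (typer-wave file F1a of the cell `gate-hubbard-kl`; source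
BGM06 = G. Benfatto, A. Giuliani, V. Mastropietro, *Fermi liquid behavior in the 2D Hubbard model at low
temperatures*, Ann. Henri Poincaré **7** (2006) 809–898, arXiv:cond-mat/0507686; locators `p00NN:Lnn` =
chunk/line of the `lit read` render of the arXiv TeX).

The decay (2.52) of the ANISOTROPIC sector propagator `g^{(h)}_ω` (named fact `BGM2006_Lemma_2_2`) has the
term `γ^{-h}(γ^h|x'₂|)^N` in the tangential direction `x'₂ = x⃗·τ⃗_h(θ_{h,ω})`: integrating by parts `N`
times along `τ⃗` must cost only `γ^{-Nh}` IN TOTAL although the support of `F_{h,ω}` is `γ^{h/2}` wide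
(p0010:L47–L49) and `1/D_{h-1} = O(γ^{-h})`.  BGM, p0010:L129–p0011:L22: on the support
`|∂E_{h-1}/∂k'₂| ≤ Cγ^{h/2}` (2.53) (the Fermi point of the sector centre is a critical point of `ε_h`
along `τ⃗`, (2.54)), the higher tangential derivatives of `E_{h'}` are `O(1)`, `O(γ^{(2-b)h})` by (2.42),
and the `n`-th derivative of `ζ_{h,ω}` is `O(γ^{-nh/2})`; "it is easy to see that
`∂^N_{k'₂}[F_{h,ω}(k)/(-ik₀ + E_{h-1}(k) - μ)] = O(γ^{-Nh})` for `N ≥ 2`" (2.55).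

This file PROVES (2.55) in the TWO-SCALE PROFILE form of `BGM2006Sec2TwoScaleLeibniz`: with
`σ = γ^{h/2} = 2^h`, `ρ = γ^{-h} = 4^{-h}`, every ingredient `φ` of the integrand along the unit-speed
tangential line `s ↦ q⃗ + sτ⃗` satisfies `‖φ^{(i)}(0)‖ ≤ A σ^{min(i,2)} ρⁱ` (`i ≤ N`), hence so does
`Φ̃ = γ^h F_{h,ω}/D_{h-1}` (t1's globally smooth surrogate integrand `bgmSurrogateIntegrand` of
`BGM2006Sec2ShellLineBounds`, which IS the integrand wherever the radial plateau is `1`), i.e.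
`‖∂ₛⁱ Φ̃(k₀, q⃗ + sτ⃗)|₀‖ ≤ K σ^{min(i,2)} ρⁱ` — `= Kγ^{-(i-1)h}` for `i ≥ 2`, `Kγ^{-h/2}` for `i = 1` —
uniformly in `β, U, h, ω, k₀, q⃗`:

* §1 toolkit (private): bounded derivatives on compacta, derivatives through `Re`/`Im`/`conj`/`(· : ℂ)`,
  the squared modulus and compositions in profile form, `(2:ℝ)^{n(h)} = 2^{-h}`;
* §2 `exists_norm_iteratedDeriv_surrogateProduct_le_twoScale` — the two-scale twin of t1's core
  `exists_norm_iteratedDeriv_surrogateProduct_le`: if the rescaled denominators `a, b` and the angular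
  factor `z` have the profile at `0`, so does `[shellSurrogate(a,b)·z]·invSurrogate(b)`;
* §3 the ingredients on the support of `F_{h,ω}(k₀(j), ·)`: the rescaled denominators
  `γ^{-h}D_{h'}(k₀, q⃗ + sτ⃗)`, `h' ∈ {h, h-1}` (order `0`: (2.42a); order `1`: (2.53) from
  `BGM2006Sec2AnisoSupport`; orders `≥ 2`: (2.42) along lines from `BGM2006Sec2DerivativeBounds`), and the
  plateaued angular factor (one scale `2^{-h}` per derivative, `AngularCutoffLineBounds`);
* §4 the exports: **`exists_norm_iteratedDeriv_bgmSurrogateIntegrand_tangent_le`** — for `-4 < μ`,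
  admissible `e₀`, the constants `C` of (2.36), `N` and a smallness parameter `c₀` there is `K ≥ 0`
  such that under `E_0 = ε₀`, (2.36a), (2.36) with `|U| ≤ c₀`, `|U||h_β| ≤ c₀` and the six coupled
  smallness constraints of `exists_coupledSmallness`, for all `h_β ≤ h ≤ 0`, `ω`, `j` and EVERY `q⃗` with
  `|q_i| < 7π/4`: `‖∂ₛⁱ Φ̃_{h,n(h),ω}(k₀(j), q⃗ + sτ⃗_h(θ_{n,ω}))|₀‖ ≤ K (2^h)^{min(i,2)} (4^{-h})ⁱ` for all
  `i ≤ N` (on the support by §2–§3, on its closure by continuity, and `Φ̃ ≡ 0` near every other such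
  point); and the same for the true integrand `F_{h,ω}/D_{h-1} = γ^{-h}Φ̃` with the extra factor `4^{-h}`
  (`exists_norm_iteratedDeriv_sectorIntegrand_tangent_le`).

Everything is proved; no definitions, no named facts, no `sorry`, no instances, no notation.

## Sources

* [BGM06] G. Benfatto, A. Giuliani, V. Mastropietro, Ann. Henri Poincaré 7 (2006) 809–898,
  arXiv:cond-mat/0507686, §2.5 (2.45)–(2.49), Lemma 2.2 (2.51)–(2.52) and its proof (2.53)–(2.55)
  p0010:L107–p0011:L22; §2.4 (2.42)–(2.42a). [BenfattoGiulianiMastropietro2006]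
-/

noncomputable section

open Real Set Filter Literature.Analysis.Calculus Literature.Analysis.SpecialFunctions
open scoped Nat Topology ComplexConjugate

namespace Literature.MathematicalPhysics.QuantumLattice.FermiRG

/-! ### §1 Toolkit -/

section Toolkit

variable {V W : Type*} [NormedAddCommGroup V] [NormedSpace ℝ V] [NormedAddCommGroup W] [NormedSpace ℝ W]

/-- A common bound for finitely many orders. [folklore] -/
private theorem exists_forall_le_max_tb {P : ℕ → ℝ → Prop} (hmono : ∀ i C C', C ≤ C' → P i C → P i C')
    (hex : ∀ i, ∃ C, 0 ≤ C ∧ P i C) (N : ℕ) : ∃ C, 0 ≤ C ∧ ∀ i ≤ N, P i C := by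
  induction N with
  | zero =>
    obtain ⟨C, hC0, hC⟩ := hex 0
    exact ⟨C, hC0, fun i hi => by rw [Nat.le_zero.1 hi]; exact hC⟩
  | succ N ih =>
    obtain ⟨C₁, h1, hC₁⟩ := ih
    obtain ⟨C₂, _, hC₂⟩ := hex (N + 1)
    refine ⟨max C₁ C₂, le_max_of_le_left h1, fun i hi => ?_⟩
    rcases Nat.lt_or_ge i (N + 1) with hlt | hge
    · exact hmono _ _ _ (le_max_left _ _) (hC₁ i (Nat.lt_succ_iff.1 hlt))
    · rw [le_antisymm hi hge]; exact hmono _ _ _ (le_max_right _ _) hC₂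

/-- Derivatives of a fixed smooth function are bounded on a compact interval, all orders `≤ N` at once.
[folklore] -/
private theorem exists_norm_iteratedDeriv_le_on_Icc_tb {g : ℝ → ℝ} (hg : ∀ m : ℕ, ContDiff ℝ m g) (N : ℕ)
    (lo hi : ℝ) : ∃ C, 0 ≤ C ∧ ∀ i ≤ N, ∀ y ∈ Icc lo hi, ‖iteratedDeriv i g y‖ ≤ C := by
  refine exists_forall_le_max_tb (P := fun i C => ∀ y ∈ Icc lo hi, ‖iteratedDeriv i g y‖ ≤ C)
    (fun i C C' hCC' hP y hy => (hP y hy).trans hCC') (fun i => ?_) N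
  have hcont : Continuous (iteratedDeriv i g) := (hg i).continuous_iteratedDeriv' i
  obtain ⟨C, hC⟩ := isCompact_Icc.exists_bound_of_continuousOn hcont.continuousOn
  exact ⟨max C 0, le_max_right _ _, fun y hy => (hC y hy).trans (le_max_left _ _)⟩

/-- A continuous linear map commutes with `iteratedDeriv`. [folklore] -/
private theorem iteratedDeriv_clm_apply_tb (L : V →L[ℝ] W) {a : ℝ → V} {n : ℕ} (ha : ContDiff ℝ n a)
    {i : ℕ} (hi : i ≤ n) (σ : ℝ) : iteratedDeriv i (fun σ => L (a σ)) σ = L (iteratedDeriv i a σ) := by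
  rw [iteratedDeriv_eq_iteratedFDeriv, iteratedDeriv_eq_iteratedFDeriv,
    show (fun σ => L (a σ)) = L ∘ a from rfl,
    L.iteratedFDeriv_comp_left ha.contDiffAt (i := i) (by exact_mod_cast hi)]
  rfl

/-- Real parts: `∂ⁱ Re a = Re ∂ⁱ a`. [folklore] -/
private theorem iteratedDeriv_re_tb {a : ℝ → ℂ} {n : ℕ} (ha : ContDiff ℝ n a) {i : ℕ} (hi : i ≤ n) (σ : ℝ) :
    iteratedDeriv i (fun σ => (a σ).re) σ = (iteratedDeriv i a σ).re := by
  have h := iteratedDeriv_clm_apply_tb Complex.reCLM ha hi σ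
  simpa only [Complex.reCLM_apply] using h

/-- Imaginary parts: `∂ⁱ Im a = Im ∂ⁱ a`. [folklore] -/
private theorem iteratedDeriv_im_tb {a : ℝ → ℂ} {n : ℕ} (ha : ContDiff ℝ n a) {i : ℕ} (hi : i ≤ n) (σ : ℝ) :
    iteratedDeriv i (fun σ => (a σ).im) σ = (iteratedDeriv i a σ).im := by
  have h := iteratedDeriv_clm_apply_tb Complex.imCLM ha hi σ
  simpa only [Complex.imCLM_apply] using h

/-- Conjugates: `∂ⁱ conj a = conj ∂ⁱ a`. [folklore] -/
private theorem iteratedDeriv_conj_tb {a : ℝ → ℂ} {n : ℕ} (ha : ContDiff ℝ n a) {i : ℕ} (hi : i ≤ n) (σ : ℝ) :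
    iteratedDeriv i (fun σ => conj (a σ)) σ = conj (iteratedDeriv i a σ) := by
  have h := iteratedDeriv_clm_apply_tb (Complex.conjCLE : ℂ →L[ℝ] ℂ) ha hi σ
  simpa only [ContinuousLinearEquiv.coe_coe, Complex.conjCLE_apply] using h

/-- Real embedding: `∂ⁱ (r : ℂ) = (∂ⁱ r : ℂ)`. [folklore] -/
private theorem iteratedDeriv_ofReal_tb {r : ℝ → ℝ} {n : ℕ} (hr : ContDiff ℝ n r) {i : ℕ} (hi : i ≤ n) (σ : ℝ) :
    iteratedDeriv i (fun σ => ((r σ : ℝ) : ℂ)) σ = ((iteratedDeriv i r σ : ℝ) : ℂ) := by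
  have h := iteratedDeriv_clm_apply_tb Complex.ofRealCLM hr hi σ
  simpa only [Complex.ofRealCLM_apply] using h

/-- **Profile from the three regimes**: order `0`, order `1` (one factor `σ`), orders `≥ 2` (the factor `σ²`).
[folklore] -/
private theorem profile_of_cases {ψ : ℝ → V} {N : ℕ} {X σ ρ : ℝ} (h0 : ‖ψ 0‖ ≤ X)
    (h1 : 1 ≤ N → ‖iteratedDeriv 1 ψ 0‖ ≤ X * (σ * ρ))
    (h2 : ∀ l, 2 ≤ l → l ≤ N → ‖iteratedDeriv l ψ 0‖ ≤ X * (σ ^ 2 * ρ ^ l)) :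
    ∀ l ≤ N, ‖iteratedDeriv l ψ 0‖ ≤ X * σ ^ min l 2 * ρ ^ l := by
  intro l hl
  rcases Nat.lt_or_ge l 2 with hlt | hge
  · interval_cases l
    · simpa using h0
    · have := h1 hl; simpa [mul_assoc] using this
  · rw [min_eq_right hge, mul_assoc]; exact h2 l hge hl

/-- **The squared modulus keeps the profile**: `a ∈ P(M)` at `0` ⇒ `|a|² ∈ P(2^{n+1}M²)` (Leibniz on
`Re² + Im²`). [folklore] -/
private theorem norm_iteratedDeriv_norm_sq_le_twoScale {a : ℝ → ℂ} {n : ℕ} (ha : ContDiff ℝ n a) {M σ ρ : ℝ}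
    (hσ0 : 0 ≤ σ) (hσ1 : σ ≤ 1) (hρ : 0 ≤ ρ) (hM : ∀ j ≤ n, ‖iteratedDeriv j a 0‖ ≤ M * σ ^ min j 2 * ρ ^ j) :
    ∀ i ≤ n, ‖iteratedDeriv i (fun s => ‖a s‖ ^ 2) 0‖ ≤ 2 ^ (n + 1) * M ^ 2 * σ ^ min i 2 * ρ ^ i := by
  have hre : ContDiff ℝ n fun s => (a s).re := Complex.reCLM.contDiff.comp ha
  have him : ContDiff ℝ n fun s => (a s).im := Complex.imCLM.contDiff.comp ha
  have hfun : (fun s => ‖a s‖ ^ 2) = fun s => (a s).re * (a s).re + (a s).im * (a s).im := by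
    funext s; rw [Complex.sq_norm, Complex.normSq_apply]
  have hAre : ∀ j ≤ n, ‖iteratedDeriv j (fun s => (a s).re) 0‖ ≤ M * σ ^ min j 2 * ρ ^ j := fun j hj => by
    rw [iteratedDeriv_re_tb ha hj, Real.norm_eq_abs]
    exact (Complex.abs_re_le_norm _).trans (hM j hj)
  have hAim : ∀ j ≤ n, ‖iteratedDeriv j (fun s => (a s).im) 0‖ ≤ M * σ ^ min j 2 * ρ ^ j := fun j hj => by
    rw [iteratedDeriv_im_tb ha hj, Real.norm_eq_abs]
    exact (Complex.abs_im_le_norm _).trans (hM j hj)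
  have h1 : ∀ i ≤ n, ‖iteratedDeriv i (fun s => (a s).re * (a s).re) 0‖ ≤ 2 ^ n * M * M * σ ^ min i 2 * ρ ^ i :=
    fun i hi => norm_iteratedDeriv_mul_le_twoScale isOpen_univ (mem_univ _) hre.contDiffOn hre.contDiffOn
      hσ0 hσ1 hρ hAre hAre hi
  have h2 : ∀ i ≤ n, ‖iteratedDeriv i (fun s => (a s).im * (a s).im) 0‖ ≤ 2 ^ n * M * M * σ ^ min i 2 * ρ ^ i :=
    fun i hi => norm_iteratedDeriv_mul_le_twoScale isOpen_univ (mem_univ _) him.contDiffOn him.contDiffOn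
      hσ0 hσ1 hρ hAim hAim hi
  have h3 := norm_iteratedDeriv_add_le_twoScale (hre.mul hre).contDiffAt (him.mul him).contDiffAt h1 h2
  intro i hi
  rw [hfun]
  refine (h3 i hi).trans (le_of_eq ?_)
  ring

/-- **Composition with a fixed smooth outer function in profile form**: if `f ∈ P(A)` at `0` is real with
`f(0) ∈ [lo, hi]` and `|g^{(m)}| ≤ C_G` on `[lo, hi]` for `m ≤ n`, then `g ∘ f ∈ P(C_G (2ⁿ(1+A))ⁿ)`. [folklore] -/
private theorem norm_iteratedDeriv_comp_le_twoScale_of_Icc {g : ℝ → ℝ} (hg : ∀ m : ℕ, ContDiff ℝ m g) {n : ℕ}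
    {lo hi CG : ℝ} (hCG : ∀ i ≤ n, ∀ y ∈ Icc lo hi, ‖iteratedDeriv i g y‖ ≤ CG) {f : ℝ → ℝ}
    (hf : ContDiff ℝ n f) (hf0 : f 0 ∈ Icc lo hi) {A σ ρ : ℝ} (hσ0 : 0 ≤ σ) (hσ1 : σ ≤ 1) (hρ : 0 ≤ ρ)
    (hA0 : 0 ≤ A) (hA : ∀ i ≤ n, ‖iteratedDeriv i f 0‖ ≤ A * σ ^ min i 2 * ρ ^ i) :
    ∀ k ≤ n, ‖iteratedDeriv k (fun s => g (f s)) 0‖ ≤ CG * (2 ^ n * (1 + A)) ^ n * σ ^ min k 2 * ρ ^ k :=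
  norm_iteratedDeriv_comp_le_twoScale' isOpen_univ isOpen_univ (mem_univ 0) hf.contDiffOn (mapsTo_univ _ _)
    hσ0 hσ1 hρ hA0 (fun i _ hi => hA i hi) (hg n).contDiffOn (fun m hm => hCG m hm _ hf0)

/-- `2^{n(h)} = 2^{-h}` for the anisotropic angular index `n(h) = -h`. [folklore] -/
private theorem two_pow_bgmScaleIdx {h : ℤ} (hh₀ : h ≤ 0) : (2 : ℝ) ^ bgmScaleIdx h = (2 : ℝ) ^ (-h) := by
  rw [bgmScaleIdx, ← zpow_natCast]
  congr 1
  exact Int.toNat_of_nonneg (by omega)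

/-- `2^h · 4^{-h} = 2^{-h}` (`σρ = γ^{-h/2}`). [folklore] -/
private theorem two_zpow_mul_four_zpow_neg (h : ℤ) : (2 : ℝ) ^ h * (4 : ℝ) ^ (-h) = (2 : ℝ) ^ (-h) := by
  rw [show (4 : ℝ) = 2 ^ 2 by norm_num, ← zpow_natCast, ← zpow_mul, ← zpow_add₀ (by norm_num : (2 : ℝ) ≠ 0)]
  congr 1; push_cast; ring

/-- The relative angle of `k⃗` to its own polar angle is `0`. [folklore] -/
private theorem sectorRelAngle_polarAngle_self_tb (k : Fin 2 → ℝ) : sectorRelAngle (polarAngle k) k = 0 := by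
  rw [sectorRelAngle, polarAngle]
  have h1 : momToComplex k * Complex.exp (-((Complex.arg (momToComplex k) : ℂ) * Complex.I)) =
      ((‖momToComplex k‖ : ℝ) : ℂ) := by
    have h := Complex.norm_mul_exp_arg_mul_I (momToComplex k)
    calc momToComplex k * Complex.exp (-((Complex.arg (momToComplex k) : ℂ) * Complex.I))
        = (((‖momToComplex k‖ : ℝ) : ℂ) * Complex.exp ((Complex.arg (momToComplex k) : ℂ) * Complex.I)) *
            Complex.exp (-((Complex.arg (momToComplex k) : ℂ) * Complex.I)) := by rw [h]
      _ = _ := by rw [mul_assoc, ← Complex.exp_add, add_neg_cancel, Complex.exp_zero, mul_one]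
  rw [h1, Complex.arg_ofReal_of_nonneg (norm_nonneg _)]

/-- The unit tangent has modulus `1` as a complex number. [folklore] -/
private theorem norm_momToComplex_polarTangent {u : ℝ → ℝ} {θ : ℝ} (hu : 0 < u θ) :
    ‖momToComplex (polarTangent u θ)‖ = 1 := by
  have h := norm_momToComplex_sq (polarTangent u θ)
  rw [polarTangent_sq_add_sq u θ hu] at h
  exact (pow_eq_one_iff_of_nonneg (norm_nonneg _) two_ne_zero).1 h

/-- `(π/4)² < (3π/4)²`. [folklore] -/
private theorem sq_pi_div_four_lt_tb : (π / 4) ^ 2 < (3 * π / 4) ^ 2 := by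
  nlinarith [Real.pi_pos]

end Toolkit

/-! ### §2 The two-scale core: `[shellSurrogate(a,b) · z] · invSurrogate(b)` in profile form -/

section Core

/-- **The shell surrogate in profile form**: if the rescaled denominators `a, b : ℝ → ℂ` have the two-scale
profile `‖a^{(j)}(0)‖, ‖b^{(j)}(0)‖ ≤ M σ^{min(j,2)} ρʲ` (`j ≤ N`), then so does
`s ↦ f_h = G(|a|²) - G(16|b|²)` with a constant depending on `N, e₀, M` only (Faà di Bruno through the
smooth `G = H₀(√·)`, whose derivatives are bounded on `[0, 16M²]`). [cite: BenfattoGiulianiMastropietro2006, §2.5 proof of Lemma 2.2 (2.55) p0011:L17–L22] -/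
theorem exists_norm_iteratedDeriv_shellSurrogate_le_twoScale {e₀ : ℝ} (he : 0 < e₀) (N : ℕ) (M : ℝ) :
    ∃ K : ℝ, 0 ≤ K ∧ ∀ (a b : ℝ → ℂ) (σ ρ : ℝ), 0 ≤ σ → σ ≤ 1 → 0 ≤ ρ → ContDiff ℝ N a → ContDiff ℝ N b →
      (∀ j ≤ N, ‖iteratedDeriv j a 0‖ ≤ M * σ ^ min j 2 * ρ ^ j) →
      (∀ j ≤ N, ‖iteratedDeriv j b 0‖ ≤ M * σ ^ min j 2 * ρ ^ j) →
      ∀ i ≤ N, ‖iteratedDeriv i (fun s => bgmShellSurrogate e₀ (a s) (b s)) 0‖ ≤ K * σ ^ min i 2 * ρ ^ i := by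
  obtain ⟨CG, hCG0, hCG⟩ := exists_norm_iteratedDeriv_le_on_Icc_tb (g := bgmCutoffSq e₀)
    (fun m => contDiff_bgmCutoffSq he) N 0 (16 * M ^ 2)
  set Au : ℝ := 2 ^ (N + 1) * M ^ 2 with hAu
  have hAu0 : 0 ≤ Au := by positivity
  refine ⟨CG * (2 ^ N * (1 + Au)) ^ N + CG * (2 ^ N * (1 + 16 * Au)) ^ N, by positivity,
    fun a b σ ρ hσ0 hσ1 hρ ha hb hMa hMb => ?_⟩
  -- the two inner functions
  have hua : ContDiff ℝ N fun s => ‖a s‖ ^ 2 := ha.norm_sq ℝ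
  have hub : ContDiff ℝ N fun s => ‖b s‖ ^ 2 := hb.norm_sq ℝ
  have hub' : ContDiff ℝ N fun s => (16 : ℝ) • ‖b s‖ ^ 2 := hub.const_smul (16 : ℝ)
  have hPa := norm_iteratedDeriv_norm_sq_le_twoScale ha hσ0 hσ1 hρ hMa
  have hPb := norm_iteratedDeriv_norm_sq_le_twoScale hb hσ0 hσ1 hρ hMb
  have hPb' : ∀ i ≤ N, ‖iteratedDeriv i (fun s => (16 : ℝ) • ‖b s‖ ^ 2) 0‖ ≤ 16 * Au * σ ^ min i 2 * ρ ^ i := by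
    intro i hi
    have h := norm_iteratedDeriv_const_smul_le_twoScale hub.contDiffAt (16 : ℝ) hPb i hi
    rw [Real.norm_of_nonneg (by norm_num : (0 : ℝ) ≤ 16)] at h
    rw [hAu]; exact h
  -- values at `0`
  have ha0 : ‖a 0‖ ≤ M := by have := hMa 0 (Nat.zero_le _); simpa using this
  have hb0 : ‖b 0‖ ≤ M := by have := hMb 0 (Nat.zero_le _); simpa using this
  have hva : (fun s => ‖a s‖ ^ 2) 0 ∈ Icc (0 : ℝ) (16 * M ^ 2) := by
    refine ⟨by positivity, ?_⟩
    have := pow_le_pow_left₀ (norm_nonneg _) ha0 2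
    show ‖a 0‖ ^ 2 ≤ 16 * M ^ 2
    nlinarith [sq_nonneg M]
  have hvb : (fun s => (16 : ℝ) • ‖b s‖ ^ 2) 0 ∈ Icc (0 : ℝ) (16 * M ^ 2) := by
    refine ⟨by positivity, ?_⟩
    have := pow_le_pow_left₀ (norm_nonneg _) hb0 2
    show (16 : ℝ) • ‖b 0‖ ^ 2 ≤ 16 * M ^ 2
    rw [smul_eq_mul]; nlinarith
  have hGa := norm_iteratedDeriv_comp_le_twoScale_of_Icc (fun m => contDiff_bgmCutoffSq he) hCG hua hva
    hσ0 hσ1 hρ hAu0 hPa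
  have hGb := norm_iteratedDeriv_comp_le_twoScale_of_Icc (fun m => contDiff_bgmCutoffSq he) hCG hub' hvb
    hσ0 hσ1 hρ (by positivity) hPb'
  have hcd1 : ContDiffAt ℝ N (fun s => bgmCutoffSq e₀ (‖a s‖ ^ 2)) 0 := ((contDiff_bgmCutoffSq he).comp hua).contDiffAt
  have hcd2 : ContDiffAt ℝ N (fun s => bgmCutoffSq e₀ ((16 : ℝ) • ‖b s‖ ^ 2)) 0 :=
    ((contDiff_bgmCutoffSq he).comp hub').contDiffAt
  have hfun : (fun s => bgmShellSurrogate e₀ (a s) (b s)) =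
      fun s => bgmCutoffSq e₀ (‖a s‖ ^ 2) - bgmCutoffSq e₀ ((16 : ℝ) • ‖b s‖ ^ 2) := by
    funext s; simp [bgmShellSurrogate, smul_eq_mul]
  rw [hfun]
  exact norm_iteratedDeriv_sub_le_twoScale hcd1 hcd2 hGa hGb

/-- **The inverse surrogate in profile form**: if `b : ℝ → ℂ` has the two-scale profile with constant `M`
at `0`, then so does `s ↦ conj(b) η(|b|²)` (`= 1/b` on `|b| ≥ e₀/16`) with a constant depending on
`N, e₀, M` only (`η` smooth with derivatives bounded on `[0, M²]`). [cite: BenfattoGiulianiMastropietro2006, §2.5 proof of Lemma 2.2 (2.55) p0011:L17–L22] -/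
theorem exists_norm_iteratedDeriv_invSurrogate_le_twoScale {e₀ : ℝ} (he : 0 < e₀) (N : ℕ) {M : ℝ} (hM0 : 0 ≤ M) :
    ∃ K : ℝ, 0 ≤ K ∧ ∀ (b : ℝ → ℂ) (σ ρ : ℝ), 0 ≤ σ → σ ≤ 1 → 0 ≤ ρ → ContDiff ℝ N b →
      (∀ j ≤ N, ‖iteratedDeriv j b 0‖ ≤ M * σ ^ min j 2 * ρ ^ j) →
      ∀ i ≤ N, ‖iteratedDeriv i (fun s => bgmInvSurrogate e₀ (b s)) 0‖ ≤ K * σ ^ min i 2 * ρ ^ i := by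
  have hq₀ : 0 < e₀ ^ 2 / 128 := by positivity
  obtain ⟨Cη, hCη0, hCη⟩ := exists_norm_iteratedDeriv_le_on_Icc_tb (g := sectorInvCutoff (e₀ ^ 2 / 128))
    (fun m => contDiff_sectorInvCutoff hq₀) N 0 (M ^ 2)
  set Au : ℝ := 2 ^ (N + 1) * M ^ 2 with hAu
  have hAu0 : 0 ≤ Au := by positivity
  set Aη : ℝ := Cη * (2 ^ N * (1 + Au)) ^ N with hAη
  refine ⟨2 ^ N * M * Aη, by positivity, fun b σ ρ hσ0 hσ1 hρ hb hMb => ?_⟩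
  have hub : ContDiff ℝ N fun s => ‖b s‖ ^ 2 := hb.norm_sq ℝ
  have hPb := norm_iteratedDeriv_norm_sq_le_twoScale hb hσ0 hσ1 hρ hMb
  have hb0 : ‖b 0‖ ≤ M := by have := hMb 0 (Nat.zero_le _); simpa using this
  have hvb : (fun s => ‖b s‖ ^ 2) 0 ∈ Icc (0 : ℝ) (M ^ 2) :=
    ⟨by positivity, pow_le_pow_left₀ (norm_nonneg _) hb0 2⟩
  have hη := norm_iteratedDeriv_comp_le_twoScale_of_Icc (fun m => contDiff_sectorInvCutoff hq₀) hCη hub hvb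
    hσ0 hσ1 hρ hAu0 hPb
  -- the real factor cast to `ℂ`, and the conjugate factor
  have hηc : ContDiff ℝ N fun s => sectorInvCutoff (e₀ ^ 2 / 128) (‖b s‖ ^ 2) := (contDiff_sectorInvCutoff hq₀).comp hub
  have hηC : ContDiff ℝ N fun s => ((sectorInvCutoff (e₀ ^ 2 / 128) (‖b s‖ ^ 2) : ℝ) : ℂ) :=
    Complex.ofRealCLM.contDiff.comp hηc
  have hPηC : ∀ i ≤ N, ‖iteratedDeriv i (fun s => ((sectorInvCutoff (e₀ ^ 2 / 128) (‖b s‖ ^ 2) : ℝ) : ℂ)) 0‖ ≤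
      Aη * σ ^ min i 2 * ρ ^ i := fun i hi => by
    rw [iteratedDeriv_ofReal_tb hηc hi, Complex.norm_real]; exact hη i hi
  have hconj : ContDiff ℝ N fun s => conj (b s) := Complex.conjCLE.contDiff.comp hb
  have hPconj : ∀ i ≤ N, ‖iteratedDeriv i (fun s => conj (b s)) 0‖ ≤ M * σ ^ min i 2 * ρ ^ i := fun i hi => by
    rw [iteratedDeriv_conj_tb hb hi, RCLike.norm_conj]; exact hMb i hi
  have hfun : (fun s => bgmInvSurrogate e₀ (b s)) =
      fun s => conj (b s) * ((sectorInvCutoff (e₀ ^ 2 / 128) (‖b s‖ ^ 2) : ℝ) : ℂ) := by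
    funext s; rfl
  rw [hfun]
  intro i hi
  exact norm_iteratedDeriv_mul_le_twoScale isOpen_univ (mem_univ _) hconj.contDiffOn hηC.contDiffOn hσ0 hσ1 hρ
    hPconj hPηC hi

/-- **The two-scale core estimate (all orders `≤ N`, one tangential line).**  For every `N`, `M ≥ 0`, `Z ≥ 0`
there is `K ≥ 0` (depending on `N, e₀, M, Z` only) such that: if the rescaled denominators
`a = γ^{-h}D_h`, `b = γ^{-h}D_{h-1}` along the line and the angular factor `z` satisfy the two-scale profile
`‖·^{(j)}(0)‖ ≤ M σ^{min(j,2)} ρʲ` (resp. `Z σ^{min(j,2)} ρʲ`) for `j ≤ N` (`0 ≤ σ ≤ 1`, `ρ ≥ 0`), then every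
derivative of order `i ≤ N` at `0` of `s ↦ [shellSurrogate(a, b) · z] · invSurrogate(b)` is
`≤ K σ^{min(i,2)} ρⁱ` — BGM's "using (2.53), (2.42) and the fact that the `n`-th order derivative of
`ζ_{h,ω}` is of order `γ^{-nh/2}`, `∂^N_{k'₂}[F_{h,ω}/D_{h-1}] = O(γ^{-Nh})`", the `γ^{-h}` of `1/D_{h-1}`
having been moved into the rescaling. [cite: BenfattoGiulianiMastropietro2006, §2.5 proof of Lemma 2.2 (2.53)–(2.55) p0011:L7–L22] -/
theorem exists_norm_iteratedDeriv_surrogateProduct_le_twoScale {e₀ : ℝ} (he : 0 < e₀) (N : ℕ) {M Z : ℝ}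
    (hM0 : 0 ≤ M) (hZ0 : 0 ≤ Z) :
    ∃ K : ℝ, 0 ≤ K ∧ ∀ (a b : ℝ → ℂ) (z : ℝ → ℝ) (σ ρ : ℝ), 0 ≤ σ → σ ≤ 1 → 0 ≤ ρ →
      ContDiff ℝ N a → ContDiff ℝ N b → ContDiff ℝ N z →
      (∀ j ≤ N, ‖iteratedDeriv j a 0‖ ≤ M * σ ^ min j 2 * ρ ^ j) →
      (∀ j ≤ N, ‖iteratedDeriv j b 0‖ ≤ M * σ ^ min j 2 * ρ ^ j) →
      (∀ j ≤ N, ‖iteratedDeriv j z 0‖ ≤ Z * σ ^ min j 2 * ρ ^ j) →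
      ∀ i ≤ N, ‖iteratedDeriv i (fun s => ((bgmShellSurrogate e₀ (a s) (b s) * z s : ℝ) : ℂ) *
        bgmInvSurrogate e₀ (b s)) 0‖ ≤ K * σ ^ min i 2 * ρ ^ i := by
  obtain ⟨K₁, hK₁0, hK₁⟩ := exists_norm_iteratedDeriv_shellSurrogate_le_twoScale he N M
  obtain ⟨K₂, hK₂0, hK₂⟩ := exists_norm_iteratedDeriv_invSurrogate_le_twoScale he N hM0
  refine ⟨2 ^ N * (2 ^ N * K₁ * Z) * K₂, by positivity, fun a b z σ ρ hσ0 hσ1 hρ ha hb hz hMa hMb hZ i hi => ?_⟩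
  have hS : ContDiff ℝ N fun s => bgmShellSurrogate e₀ (a s) (b s) := contDiff_bgmShellSurrogate_comp he ha hb
  have hSz : ∀ j ≤ N, ‖iteratedDeriv j (fun s => bgmShellSurrogate e₀ (a s) (b s) * z s) 0‖ ≤
      2 ^ N * K₁ * Z * σ ^ min j 2 * ρ ^ j := fun j hj =>
    norm_iteratedDeriv_mul_le_twoScale isOpen_univ (mem_univ _) hS.contDiffOn hz.contDiffOn hσ0 hσ1 hρ
      (hK₁ a b σ ρ hσ0 hσ1 hρ ha hb hMa hMb) hZ hj
  have hSzC : ∀ j ≤ N, ‖iteratedDeriv j (fun s => ((bgmShellSurrogate e₀ (a s) (b s) * z s : ℝ) : ℂ)) 0‖ ≤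
      2 ^ N * K₁ * Z * σ ^ min j 2 * ρ ^ j := fun j hj => by
    rw [iteratedDeriv_ofReal_tb (hS.mul hz) hj, Complex.norm_real]; exact hSz j hj
  have hcd1 : ContDiff ℝ N fun s => ((bgmShellSurrogate e₀ (a s) (b s) * z s : ℝ) : ℂ) :=
    Complex.ofRealCLM.contDiff.comp (hS.mul hz)
  have hcd2 : ContDiff ℝ N fun s => bgmInvSurrogate e₀ (b s) := contDiff_bgmInvSurrogate_comp he hb
  exact norm_iteratedDeriv_mul_le_twoScale isOpen_univ (mem_univ _) hcd1.contDiffOn hcd2.contDiffOn hσ0 hσ1 hρ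
    hSzC (hK₂ b σ ρ hσ0 hσ1 hρ hb hMb) hi

end Core

/-! ### §3 The ingredients on the support of `F_{h,ω}(k₀(j), ·)` along the tangential line -/

section Ingredients

variable {μ e₀ β U c₀ : ℝ} {C : ℕ → ℝ} {hβ : ℤ} {E : ℤ → ℝ × (Fin 2 → ℝ) → ℂ} {h : ℤ}

/-- `U²h'² ≤ 4c₀²` for `h_β - 1 ≤ h' ≤ 0` under `|U| ≤ c₀`, `|U||h_β| ≤ c₀`. [folklore] -/
private theorem U_sq_mul_sq_le_four_tb (hhβ : hβ ≤ 0) {h' : ℤ} (hh'₁ : hβ - 1 ≤ h') (hh'₀ : h' ≤ 0)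
    (hU : |U| ≤ c₀) (hUh : |U| * |(hβ : ℝ)| ≤ c₀) : U ^ 2 * (h' : ℝ) ^ 2 ≤ 4 * c₀ ^ 2 := by
  have h1 : |(h' : ℝ)| ≤ |(hβ : ℝ)| + 1 := by
    rw [abs_of_nonpos (by exact_mod_cast hh'₀), abs_of_nonpos (by exact_mod_cast hhβ)]
    have : ((hβ : ℤ) : ℝ) - 1 ≤ (h' : ℝ) := by exact_mod_cast hh'₁
    linarith
  have h2 : |U| * |(h' : ℝ)| ≤ 2 * c₀ := by
    calc |U| * |(h' : ℝ)| ≤ |U| * (|(hβ : ℝ)| + 1) := mul_le_mul_of_nonneg_left h1 (abs_nonneg _)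
      _ = |U| * |(hβ : ℝ)| + |U| := by ring
      _ ≤ c₀ + c₀ := add_le_add hUh hU
      _ = 2 * c₀ := by ring
  have h3 : U ^ 2 * (h' : ℝ) ^ 2 = (|U| * |(h' : ℝ)|) ^ 2 := by rw [mul_pow, sq_abs, sq_abs]
  rw [h3]
  have h0 : 0 ≤ |U| * |(h' : ℝ)| := by positivity
  nlinarith

/-- **(2.42) along a line, orders `b ≥ 2`, in the tangential normalisation**: for `h' ∈ {h, h-1}` and any
direction with `|w|₁ ≤ 2`, `γ^{-h}‖∂ₛᵇ E_{h'}(k₀, q⃗ + sw⃗)|₀‖ ≤ A_E γ^h (γ^{-h})ᵇ` with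
`A_E = (2 + 4^{N+1}c₀² Σ_{i≤N}|C_i|)2^N`: the second tangential derivative is `O(1)` and the `b`-th is
`O(γ^{(2-b)h})` ((2.42) with `|U||h| ≤ c₀`), which is exactly `σ²ρᵇ` after the overall `γ^{-h}`.
[cite: BenfattoGiulianiMastropietro2006, §2.4 (2.42) p0009:L101, §2.5 proof of Lemma 2.2 (2.55) p0011:L17–L22] -/
theorem norm_iteratedDeriv_dispersion_tangent_le (hI : BGMInitial E) (hS : BGMSmoothness β U C hβ E)
    (hh₁ : hβ ≤ h) (hh₀ : h ≤ 0) {h' : ℤ} (hh' : h' = h ∨ h' = h - 1) (hU : |U| ≤ c₀)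
    (hUh : |U| * |(hβ : ℝ)| ≤ c₀) {k₀ : ℝ} (hk₀ : k₀ ∈ matsubaraSet β) (q w : Fin 2 → ℝ)
    (hw : |w 0| + |w 1| ≤ 2) (N : ℕ) {b : ℕ} (hb2 : 2 ≤ b) (hbN : b ≤ N) :
    (4 : ℝ) ^ (-h) * ‖iteratedDeriv b (fun s : ℝ => E h' (k₀, q + s • w)) 0‖ ≤
      ((2 + 4 ^ (N + 1) * c₀ ^ 2 * ∑ i ∈ Finset.range (N + 1), |C i|) * 2 ^ N) *
        ((4 : ℝ) ^ h * ((4 : ℝ) ^ (-h)) ^ b) := by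
  have hc₀ : 0 ≤ c₀ := (abs_nonneg U).trans hU
  have hhβ : hβ ≤ 0 := hh₁.trans hh₀
  have hh'₁ : hβ - 1 ≤ h' := by rcases hh' with rfl | rfl <;> omega
  have hh'₀ : h' ≤ 0 := by rcases hh' with rfl | rfl <;> omega
  have h1 := norm_iteratedDeriv_slice_line_le hI hS hh'₁ hh'₀ hb2 hk₀ q w 0
  have h4n : (0 : ℝ) < (4 : ℝ) ^ (-h) := zpow_pos (by norm_num) _
  have h4h : (0 : ℝ) < (4 : ℝ) ^ h := zpow_pos (by norm_num) _
  have hw0 : 0 ≤ |w 0| + |w 1| := by positivity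
  have hwb : (|w 0| + |w 1|) ^ b ≤ 2 ^ N :=
    (pow_le_pow_left₀ hw0 hw b).trans (pow_le_pow_right₀ (by norm_num) hbN)
  have hUh' := U_sq_mul_sq_le_four_tb hhβ hh'₁ hh'₀ hU hUh
  have hCle : |C b| ≤ ∑ i ∈ Finset.range (N + 1), |C i| :=
    Finset.single_le_sum (f := fun i => |C i|) (fun i _ => abs_nonneg _)
      (Finset.mem_range.2 (Nat.lt_succ_of_le hbN))
  have hS0 : 0 ≤ ∑ i ∈ Finset.range (N + 1), |C i| := Finset.sum_nonneg fun i _ => abs_nonneg _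
  set X : ℝ := (4 : ℝ) ^ h * ((4 : ℝ) ^ (-h)) ^ b with hX
  have hX0 : 0 ≤ X := by positivity
  -- the scale arithmetic
  have hρb : ((4 : ℝ) ^ (-h)) ^ b = (4 : ℝ) ^ (-h * b) := by rw [← zpow_natCast, ← zpow_mul]
  have hb2' : (2 : ℤ) ≤ b := by exact_mod_cast hb2
  have hprod : 0 ≤ ((b : ℤ) - 2) * (-h) := mul_nonneg (sub_nonneg.2 hb2') (neg_nonneg.2 hh₀)
  have key1 : (4 : ℝ) ^ (-h) ≤ X := by
    rw [hX, hρb, ← zpow_add₀ (by norm_num : (4 : ℝ) ≠ 0)]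
    exact zpow_le_zpow_right₀ (by norm_num : (1 : ℝ) ≤ 4) (by nlinarith [hprod])
  have key2 : (4 : ℝ) ^ (-h) * (4 : ℝ) ^ ((2 - (b : ℤ)) * h') ≤ 4 ^ b * X := by
    rw [hX, hρb, ← zpow_add₀ (by norm_num : (4 : ℝ) ≠ 0), ← zpow_add₀ (by norm_num : (4 : ℝ) ≠ 0),
      ← zpow_natCast, ← zpow_add₀ (by norm_num : (4 : ℝ) ≠ 0)]
    refine zpow_le_zpow_right₀ (by norm_num : (1 : ℝ) ≤ 4) ?_
    rcases hh' with rfl | rfl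
    · nlinarith [hprod]
    · nlinarith [hprod]
  have h44 : (4 : ℝ) * 4 ^ b ≤ 4 ^ (N + 1) := by
    rw [pow_succ']; exact mul_le_mul_of_nonneg_left (pow_le_pow_right₀ (by norm_num) hbN) (by norm_num)
  -- assemble
  have hterm1 : (4 : ℝ) ^ (-h) * 2 ≤ 2 * X := by linarith
  have hterm2 : (4 : ℝ) ^ (-h) * (|C b| * U ^ 2 * (h' : ℝ) ^ 2 * (4 : ℝ) ^ ((2 - (b : ℤ)) * h')) ≤
      (∑ i ∈ Finset.range (N + 1), |C i|) * (4 * c₀ ^ 2) * (4 ^ b * X) := by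
    have e : (4 : ℝ) ^ (-h) * (|C b| * U ^ 2 * (h' : ℝ) ^ 2 * (4 : ℝ) ^ ((2 - (b : ℤ)) * h')) =
        |C b| * (U ^ 2 * (h' : ℝ) ^ 2) * ((4 : ℝ) ^ (-h) * (4 : ℝ) ^ ((2 - (b : ℤ)) * h')) := by ring
    rw [e]
    have ht0 : 0 ≤ (4 : ℝ) ^ (-h) * (4 : ℝ) ^ ((2 - (b : ℤ)) * h') := by positivity
    have hu0 : 0 ≤ U ^ 2 * (h' : ℝ) ^ 2 := by positivity
    exact mul_le_mul (mul_le_mul hCle hUh' hu0 hS0) key2 ht0 (by positivity)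
  calc (4 : ℝ) ^ (-h) * ‖iteratedDeriv b (fun s : ℝ => E h' (k₀, q + s • w)) 0‖
      ≤ (4 : ℝ) ^ (-h) * ((2 + |C b| * U ^ 2 * (h' : ℝ) ^ 2 * (4 : ℝ) ^ ((2 - (b : ℤ)) * h')) *
          (|w 0| + |w 1|) ^ b) := mul_le_mul_of_nonneg_left h1 h4n.le
    _ = ((4 : ℝ) ^ (-h) * 2 + (4 : ℝ) ^ (-h) * (|C b| * U ^ 2 * (h' : ℝ) ^ 2 * (4 : ℝ) ^ ((2 - (b : ℤ)) * h'))) *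
          (|w 0| + |w 1|) ^ b := by ring
    _ ≤ (2 * X + (∑ i ∈ Finset.range (N + 1), |C i|) * (4 * c₀ ^ 2) * (4 ^ b * X)) * 2 ^ N := by
        refine mul_le_mul (add_le_add hterm1 hterm2) hwb (by positivity) (by positivity)
    _ = (2 + (4 * 4 ^ b) * c₀ ^ 2 * ∑ i ∈ Finset.range (N + 1), |C i|) * 2 ^ N * X := by ring
    _ ≤ (2 + 4 ^ (N + 1) * c₀ ^ 2 * ∑ i ∈ Finset.range (N + 1), |C i|) * 2 ^ N * X := by gcongr
    _ = _ := by rw [hX]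

/-- The rescaled denominator (2.18) along a line is smooth in the line parameter. [cite: BenfattoGiulianiMastropietro2006, §2.3 (2.18) p0007:L17] -/
theorem contDiff_scaledDenom_line (hS : BGMSmoothness β U C hβ E) (μ k₀ : ℝ) (c : ℂ) (h' : ℤ)
    (q w : Fin 2 → ℝ) {n : ℕ} : ContDiff ℝ n fun s : ℝ => c * bgmDenom μ E h' (k₀, q + s • w) := by
  have hl := contDiff_lineRestriction (hS.1 h' k₀ n) q w
  simp only [bgmDenom]
  exact contDiff_const.mul (contDiff_const.add (hl.sub contDiff_const))

/-- Derivatives of order `≥ 1` of `s ↦ c·D_{h'}(k₀, q⃗ + sw⃗)` are those of `c·E_{h'}(k₀, q⃗ + sw⃗)` (the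
`-ik₀ - μ` part of (2.18) is constant in `k⃗`). [cite: BenfattoGiulianiMastropietro2006, §2.3 (2.18) p0007:L17] -/
theorem iteratedDeriv_scaledDenom_line (hS : BGMSmoothness β U C hβ E) (μ k₀ : ℝ) (c : ℂ) (h' : ℤ)
    (q w : Fin 2 → ℝ) {i : ℕ} (hi : 1 ≤ i) (s : ℝ) :
    iteratedDeriv i (fun s : ℝ => c * bgmDenom μ E h' (k₀, q + s • w)) s =
      c * iteratedDeriv i (fun s : ℝ => E h' (k₀, q + s • w)) s := by
  have hsl : ContDiff ℝ i fun k : Fin 2 → ℝ => E h' (k₀, k) := hS.1 h' k₀ i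
  have hl := contDiff_lineRestriction hsl q w
  have hfun : (fun s : ℝ => bgmDenom μ E h' (k₀, q + s • w)) =
      fun s => (-(Complex.I * (k₀ : ℂ)) - (μ : ℂ)) + E h' (k₀, q + s • w) := by
    funext s; simp only [bgmDenom]; ring
  have hD : ContDiff ℝ i fun s : ℝ => bgmDenom μ E h' (k₀, q + s • w) := by
    rw [hfun]; exact contDiff_const.add hl
  rw [iteratedDeriv_const_mul _ hD.contDiffAt, hfun, iteratedDeriv_const_add hi]

/-- **The first tangential derivative is the directional gradient**: `∂ₛ E_{h'}(k₀, q⃗ + sw⃗)|₀ = ∇E_{h'}(k₀,·)(q⃗)·w⃗`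
(the quantity bounded by (2.53)). [cite: BenfattoGiulianiMastropietro2006, §2.5 proof of Lemma 2.2 (2.53) p0010:L135] -/
theorem iteratedDeriv_one_slice_line (hS : BGMSmoothness β U C hβ E) (h' : ℤ) (k₀ : ℝ) (q w : Fin 2 → ℝ) :
    iteratedDeriv 1 (fun s : ℝ => E h' (k₀, q + s • w)) 0 = fderiv ℝ (fun k => E h' (k₀, k)) q w := by
  rw [iteratedDeriv_lineRestriction (hS.1 h' k₀ 1) q w 0, iteratedFDeriv_one_apply, zero_smul, add_zero]

/-- **The angular factor along the unit tangential line, anisotropic sectors**: every derivative of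
`s ↦ χ(q⃗ + sτ⃗)ζ_{n(h),ω}(θ(q⃗ + sτ⃗))` at `0` costs one factor `2^{-h} = γ^{-h/2} = σρ` ("the `n`-th order
derivative of `ζ_{h,ω}(θ)` is of order `γ^{-nh/2}`"), for `|q⃗| ≥ c` (the radial plateau `χ ≡ 1` near `q⃗`)
and `|τ⃗| = 1`. [cite: BenfattoGiulianiMastropietro2006, §2.5 proof of Lemma 2.2 (2.55) p0011:L17–L20] -/
theorem norm_iteratedDeriv_angular_tangent_le (hh₀ : h ≤ 0) (ω : ℤ) (N : ℕ) {c : ℝ} (hc : 0 < c) {B : ℝ}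
    (hB0 : 0 ≤ B)
    (hB : ∀ (i : ℕ), i ≤ N → ∀ (n : ℕ) (ω : ℤ) (θ₀ : ℝ) (q w : Fin 2 → ℝ) (t : ℝ) {r₀ : ℝ}, 0 < r₀ →
      r₀ ≤ ‖momToComplex (q + t • w)‖ → |sectorRelAngle θ₀ (q + t • w)| < π →
      ‖iteratedDeriv i (fun t : ℝ => sectorWeightCirc n ω (polarAngle (q + t • w))) t‖ ≤
        B * ((1 + N !) * (2 : ℝ) ^ n * ‖momToComplex w‖ / r₀) ^ i)
    {q τ : Fin 2 → ℝ} (hq : c ≤ ‖momToComplex q‖) (hτ : ‖momToComplex τ‖ = 1) {l : ℕ} (hl : l ≤ N) :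
    ‖iteratedDeriv l (fun s : ℝ => radialCutoffC (c / 2) (momToComplex (q + s • τ)) *
        sectorWeightCirc (bgmScaleIdx h) ω (polarAngle (q + s • τ))) 0‖ ≤
      B * (max 1 ((1 + N !) / c)) ^ N * ((2 : ℝ) ^ h * (4 : ℝ) ^ (-h)) ^ l := by
  have hopen : IsOpen {s : ℝ | c / 2 < ‖momToComplex (q + s • τ)‖} :=
    isOpen_lt continuous_const (continuous_norm.comp ((contDiff_momToComplex (m := 0)).continuous.comp (by fun_prop)))
  have hmem : (0 : ℝ) ∈ {s : ℝ | c / 2 < ‖momToComplex (q + s • τ)‖} := by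
    show c / 2 < ‖momToComplex (q + (0 : ℝ) • τ)‖
    rw [zero_smul, add_zero]; linarith
  have hev : (fun s : ℝ => radialCutoffC (c / 2) (momToComplex (q + s • τ)) *
        sectorWeightCirc (bgmScaleIdx h) ω (polarAngle (q + s • τ))) =ᶠ[𝓝 0]
      fun s : ℝ => sectorWeightCirc (bgmScaleIdx h) ω (polarAngle (q + s • τ)) := by
    filter_upwards [hopen.mem_nhds hmem] with s hs
    rw [radialCutoffC_eq_one (by positivity) (le_of_lt hs), one_mul]
  rw [hev.iteratedDeriv_eq]
  have hΘ : |sectorRelAngle (polarAngle q) (q + (0 : ℝ) • τ)| < π := by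
    rw [zero_smul, add_zero, sectorRelAngle_polarAngle_self_tb q, abs_zero]; exact Real.pi_pos
  have hr : c ≤ ‖momToComplex (q + (0 : ℝ) • τ)‖ := by rw [zero_smul, add_zero]; exact hq
  have h1 := hB l hl (bgmScaleIdx h) ω (polarAngle q) q τ 0 hc hr hΘ
  refine h1.trans ?_
  rw [two_pow_bgmScaleIdx hh₀, hτ, two_zpow_mul_four_zpow_neg, mul_one]
  have e : ((1 + (N ! : ℝ)) * (2 : ℝ) ^ (-h) / c) ^ l = ((1 + N !) / c) ^ l * ((2 : ℝ) ^ (-h)) ^ l := by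
    rw [← mul_pow]; congr 1; ring
  rw [e]
  have hm1 : (1 : ℝ) ≤ max 1 ((1 + N !) / c) := le_max_left _ _
  have hx : ((1 + (N ! : ℝ)) / c) ^ l ≤ (max 1 ((1 + N !) / c)) ^ N :=
    (pow_le_pow_left₀ (by positivity) (le_max_right _ _) l).trans (pow_le_pow_right₀ hm1 hl)
  have h2 : 0 ≤ ((2 : ℝ) ^ (-h)) ^ l := by positivity
  calc B * (((1 + (N ! : ℝ)) / c) ^ l * ((2 : ℝ) ^ (-h)) ^ l)
      = B * ((1 + (N ! : ℝ)) / c) ^ l * ((2 : ℝ) ^ (-h)) ^ l := by ring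
    _ ≤ B * (max 1 ((1 + N !) / c)) ^ N * ((2 : ℝ) ^ (-h)) ^ l := by gcongr

end Ingredients

/-! ### §4 The exports: (2.55) for the surrogate integrand and for `F_{h,ω}/D_{h-1}` -/

section Export

variable {μ e₀ : ℝ}

/-- **(2.55) on the support.**  For `-4 < μ`, `0 < e₀ < μ + 4`, the constants `C` of (2.36), `N` and a
smallness parameter `c₀` there is `K ≥ 0` such that: under `E_0 = ε₀`, (2.36a), (2.36) on
`h_β ≤ h ≤ 0` with `|U| ≤ c₀`, `|U||h_β| ≤ c₀` and the six coupled smallness constraints, for every scale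
`h_β ≤ h ≤ 0`, sector `ω`, Matsubara frequency `k₀(j)` and every point `q⃗` of the disc `|q⃗| < 3π/4` with
`F_{h,ω}(k₀(j), q⃗) ≠ 0` (anisotropic index `n(h)`), all `i ≤ N`:
`‖∂ₛⁱ Φ̃(k₀(j), q⃗ + sτ⃗_h(θ_{n,ω}))|₀‖ ≤ K (2^h)^{min(i,2)} (4^{-h})ⁱ` — every tangential derivative beyond
the second costs `γ^{-h}`, the first costs `γ^{-h/2}`, the second is free.
[cite: BenfattoGiulianiMastropietro2006, §2.5 proof of Lemma 2.2 (2.53)–(2.55) p0010:L129–p0011:L22] -/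
theorem exists_norm_iteratedDeriv_bgmSurrogateIntegrand_tangent_le_of_support (hμ₁ : -4 < μ) (he : 0 < e₀)
    (he4 : e₀ < μ + 4) (C : ℕ → ℝ) (N : ℕ) (c₀ : ℝ) :
    ∃ K : ℝ, 0 ≤ K ∧ ∀ (β U : ℝ) (hβ : ℤ) (E : ℤ → ℝ × (Fin 2 → ℝ) → ℂ),
      0 < β → BGMInitial E → BGMSymmetry E → BGMSmoothness β U C hβ E → |U| ≤ c₀ → |U| * |(hβ : ℝ)| ≤ c₀ →
      |C 0| * c₀ ≤ 3 / 16 * e₀ → 2 * |C 1| * c₀ ^ 2 ≤ 1 / 2 →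
      2 * (4 * |C 2| * c₀ ^ 2) * (2 * |C 0| * c₀ + 2 * e₀) ≤ 1 →
      μ + e₀ + 2 * |C 0| * c₀ < -2 - Real.sqrt 2 → 2 * |C 0| * c₀ ≤ (μ + 4 - e₀) / 2 →
      2 * (2 * |C 1| * c₀ ^ 2) ≤ 2 / π * Real.sqrt ((μ + 4 - e₀) / 2) →
      ∀ h : ℤ, hβ ≤ h → h ≤ 0 → ∀ (ω : ℕ) (j : ℤ) (q : Fin 2 → ℝ), q 0 ^ 2 + q 1 ^ 2 < (3 * π / 4) ^ 2 →
      bgmSectorFn e₀ μ E h (bgmScaleIdx h) ω (fermiMatsubara β j, q) ≠ 0 →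
      ∀ i ≤ N, ‖iteratedDeriv i (fun s : ℝ =>
        bgmSurrogateIntegrand μ e₀ (Real.sqrt ((μ + 4 - e₀) / 2) / 2) E h (bgmScaleIdx h) ω
          (fermiMatsubara β j, q + s • polarTangent (levelRadius (bgmEffDisp β E h) μ)
            (sectorCenter (bgmScaleIdx h) ω))) 0‖ ≤
        K * ((2 : ℝ) ^ h) ^ min i 2 * ((4 : ℝ) ^ (-h)) ^ i := by
  have hπ := Real.pi_pos
  -- constants
  set c' : ℝ := Real.sqrt ((μ + 4 - e₀) / 2) with hc'
  have hc'0 : 0 < c' := by rw [hc']; exact Real.sqrt_pos.2 (by linarith)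
  have hc'sq : c' ^ 2 = (μ + 4 - e₀) / 2 := by rw [hc']; exact Real.sq_sqrt (by linarith)
  set W₀ : ℝ := (1 + 32 * |C 1| * c₀ ^ 2) * e₀ with hW₀
  set L : ℝ := π * (2 + 2 * |C 1| * c₀ ^ 2) / (2 / π * c') with hL
  set B₂ : ℝ := 2 * (π / (2 * c') * W₀) + 2 * (L + π / 4) * (3 * π / 4) with hB₂
  set B₃ : ℝ := 2 * (2 + |C 2| * c₀ ^ 2) * B₂ + 2 * ((96 * e₀ * |C 2| + |C 1|) * c₀ ^ 2) with hB₃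
  set SC : ℝ := ∑ i ∈ Finset.range (N + 1), |C i| with hSC
  set AE : ℝ := (2 + 4 ^ (N + 1) * c₀ ^ 2 * SC) * 2 ^ N with hAE
  set M : ℝ := 2 * e₀ + B₃ + AE with hM
  have hW₀0 : 0 ≤ W₀ := by positivity
  have hL0 : 0 ≤ L := by positivity
  have hB₂0 : 0 ≤ B₂ := by positivity
  have hB₃0 : 0 ≤ B₃ := by positivity
  have hSC0 : 0 ≤ SC := Finset.sum_nonneg fun i _ => abs_nonneg _
  have hAE0 : 0 ≤ AE := by positivity
  have hM0 : 0 ≤ M := by positivity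
  obtain ⟨Ba, hBa0, hBa⟩ := exists_norm_iteratedDeriv_sectorWeightCirc_polarAngle_line_le' N
  set Z : ℝ := Ba * (max 1 ((1 + N !) / c')) ^ N with hZ
  have hZ0 : 0 ≤ Z := by positivity
  obtain ⟨K, hK0, hK⟩ := exists_norm_iteratedDeriv_surrogateProduct_le_twoScale he N hM0 hZ0
  refine ⟨K, hK0, ?_⟩
  intro β U hβ E hβpos hI hSy hS hU hUh hK₀ hK₁ hK₂' hgap hgap' hδ₁ h hh₁ hh₀ ω j q hq hF i hi
  -- notation and scales
  set n := bgmScaleIdx h with hn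
  set θ₀ := sectorCenter n ω with hθ₀
  set τ := polarTangent (levelRadius (bgmEffDisp β E h) μ) θ₀ with hτ
  set k₀ := fermiMatsubara β j with hk₀def
  have hk₀ : k₀ ∈ matsubaraSet β := ⟨j, rfl⟩
  have h4h : (0 : ℝ) < (4 : ℝ) ^ h := zpow_pos (by norm_num) _
  have h4n : (0 : ℝ) < (4 : ℝ) ^ (-h) := zpow_pos (by norm_num) _
  have h2h : (0 : ℝ) < (2 : ℝ) ^ h := zpow_pos (by norm_num) _
  have hσ1 : (2 : ℝ) ^ h ≤ 1 := zpow_le_one_of_nonpos₀ (by norm_num) hh₀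
  have h4sq : (4 : ℝ) ^ h = ((2 : ℝ) ^ h) ^ 2 := by
    rw [show (4 : ℝ) = 2 ^ 2 by norm_num, ← zpow_natCast, ← zpow_mul, ← zpow_natCast, ← zpow_mul]; ring_nf
  have h42 : (4 : ℝ) ^ h ≤ (2 : ℝ) ^ h := by
    rw [h4sq, sq]; exact mul_le_of_le_one_left h2h.le hσ1
  have hinv : (4 : ℝ) ^ (-h) * (4 : ℝ) ^ h = 1 := by rw [zpow_neg, inv_mul_cancel₀ h4h.ne']
  -- the three curves
  obtain ⟨a, ha⟩ : ∃ a : ℝ → ℂ, a = fun s => (((4 : ℝ) ^ (-h) : ℝ) : ℂ) * bgmDenom μ E h (k₀, q + s • τ) := ⟨_, rfl⟩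
  obtain ⟨b, hb⟩ : ∃ b : ℝ → ℂ, b = fun s => (((4 : ℝ) ^ (-h) : ℝ) : ℂ) * bgmDenom μ E (h - 1) (k₀, q + s • τ) :=
    ⟨_, rfl⟩
  obtain ⟨z, hz⟩ : ∃ z : ℝ → ℝ, z = fun s => radialCutoffC (c' / 2) (momToComplex (q + s • τ)) *
    sectorWeightCirc n ω (polarAngle (q + s • τ)) := ⟨_, rfl⟩
  have hfun : (fun s : ℝ => bgmSurrogateIntegrand μ e₀ (c' / 2) E h n ω (k₀, q + s • τ)) =
      fun s => ((bgmShellSurrogate e₀ (a s) (b s) * z s : ℝ) : ℂ) * bgmInvSurrogate e₀ (b s) := by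
    funext s; rw [ha, hb, hz]; rfl
  rw [hfun]
  have hac : ContDiff ℝ N a := by rw [ha]; exact contDiff_scaledDenom_line hS μ k₀ _ h q τ
  have hbc : ContDiff ℝ N b := by rw [hb]; exact contDiff_scaledDenom_line hS μ k₀ _ (h - 1) q τ
  have hzc : ContDiff ℝ N z := by
    have hl : ContDiff ℝ N fun s : ℝ => q + s • τ := by fun_prop
    rw [hz]
    exact (contDiff_radial_mul_sectorWeightCirc_polarAngle (by positivity : 0 < c' / 2) n ω (m := N)).comp hl
  -- support data
  have hf : bgmShell e₀ μ E h (k₀, q) ≠ 0 := left_ne_zero_of_mul hF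
  have hη := norm_E_sub_E_le_threshold hS hh₁ hh₀ hUh hK₀ hk₀ q
  have hDa : ‖bgmDenom μ E h (k₀, q)‖ ≤ 2 * e₀ * (4 : ℝ) ^ h := by
    have h1 := norm_bgmDenom_self_lt_of_bgmShell_ne_zero he hη hf
    have h0 : 0 ≤ e₀ * (4 : ℝ) ^ h := (mul_pos he h4h).le
    linarith only [h1, h0]
  have hDb : ‖bgmDenom μ E (h - 1) (k₀, q)‖ ≤ 2 * e₀ * (4 : ℝ) ^ h :=
    (norm_bgmDenom_bounds_of_bgmShell_ne_zero he hη hf).2.le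
  -- the curve and the box
  obtain ⟨-, hcu₀, -, -, -, -⟩ := fermiCurve_data hI hS hh₁ hh₀ hU hUh he hgap hgap' he4 hδ₁ θ₀
  have hupos : 0 < levelRadius (bgmEffDisp β E h) μ θ₀ := hc'0.trans_le hcu₀
  have hτ1 : |τ 0| + |τ 1| ≤ 2 := by
    have h0 := abs_polarTangent_apply_le_one _ θ₀ hupos 0
    have h1 := abs_polarTangent_apply_le_one _ θ₀ hupos 1
    rw [hτ]; linarith only [h0, h1]
  have hτn : ‖momToComplex τ‖ = 1 := by rw [hτ]; exact norm_momToComplex_polarTangent hupos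
  obtain ⟨hS₁, -⟩ := box_of_support hI hSy hS he hβpos hh₁ hh₀ hU hUh hμ₁ hK₀ hK₁ hK₂' hgap hgap' he4 hδ₁ hq hF
  have hw : sectorWidth n = π * (2 : ℝ) ^ h := sectorWidth_bgmScaleIdx hh₀
  have hSB : |(q - levelRadius (bgmEffDisp β E h) μ θ₀ • dir θ₀) 0| +
      |(q - levelRadius (bgmEffDisp β E h) μ θ₀ • dir θ₀) 1| ≤ B₂ * (2 : ℝ) ^ h := by
    refine hS₁.trans ?_
    rw [hw]
    have e1 : 2 * (π / (2 * c') * ((1 + 32 * |C 1| * c₀ ^ 2) * (e₀ * (4 : ℝ) ^ h))) =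
        2 * (π / (2 * c') * W₀) * (4 : ℝ) ^ h := by rw [hW₀]; ring
    rw [e1]
    calc 2 * (π / (2 * c') * W₀) * (4 : ℝ) ^ h + 2 * (L + π / 4) * (3 * (π * (2 : ℝ) ^ h) / 4)
        ≤ 2 * (π / (2 * c') * W₀) * (2 : ℝ) ^ h + 2 * (L + π / 4) * (3 * (π * (2 : ℝ) ^ h) / 4) := by
          gcongr
      _ = B₂ * (2 : ℝ) ^ h := by rw [hB₂]; ring
  have hgrad : ∀ h' : ℤ, h' = h ∨ h' = h - 1 →
      ‖fderiv ℝ (fun q => E h' (k₀, q)) q τ‖ ≤ B₃ * (2 : ℝ) ^ h := by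
    intro h' hh'
    have hsl := norm_fderiv_slice_polarTangent_le hI hSy hS he hβpos hh₁ hh₀ hU hUh hμ₁ hK₀ hK₁ hK₂' hgap hgap'
      he4 hδ₁ hh' hq hF θ₀
    refine hsl.trans ?_
    calc 2 * (2 + |C 2| * c₀ ^ 2) * (|(q - levelRadius (bgmEffDisp β E h) μ θ₀ • dir θ₀) 0| +
          |(q - levelRadius (bgmEffDisp β E h) μ θ₀ • dir θ₀) 1|) +
          2 * ((96 * e₀ * |C 2| + |C 1|) * c₀ ^ 2 * (4 : ℝ) ^ h)
        ≤ 2 * (2 + |C 2| * c₀ ^ 2) * (B₂ * (2 : ℝ) ^ h) + 2 * ((96 * e₀ * |C 2| + |C 1|) * c₀ ^ 2 * (2 : ℝ) ^ h) := by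
          gcongr
      _ = B₃ * (2 : ℝ) ^ h := by rw [hB₃]; ring
  -- the profile of the rescaled denominators
  have hprof : ∀ h' : ℤ, h' = h ∨ h' = h - 1 → ‖bgmDenom μ E h' (k₀, q)‖ ≤ 2 * e₀ * (4 : ℝ) ^ h →
      ∀ l ≤ N, ‖iteratedDeriv l (fun s : ℝ => (((4 : ℝ) ^ (-h) : ℝ) : ℂ) * bgmDenom μ E h' (k₀, q + s • τ)) 0‖ ≤
        M * ((2 : ℝ) ^ h) ^ min l 2 * ((4 : ℝ) ^ (-h)) ^ l := by
    intro h' hh' hD0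
    refine profile_of_cases ?_ ?_ ?_
    · -- order 0 : `(2.42a)`
      rw [zero_smul, add_zero, norm_mul, Complex.norm_real, Real.norm_of_nonneg h4n.le]
      calc (4 : ℝ) ^ (-h) * ‖bgmDenom μ E h' (k₀, q)‖ ≤ (4 : ℝ) ^ (-h) * (2 * e₀ * (4 : ℝ) ^ h) :=
            mul_le_mul_of_nonneg_left hD0 h4n.le
        _ = 2 * e₀ * ((4 : ℝ) ^ (-h) * (4 : ℝ) ^ h) := by ring
        _ = 2 * e₀ := by rw [hinv, mul_one]
        _ ≤ M := by rw [hM]; linarith only [hB₃0, hAE0]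
    · -- order 1 : `(2.53)`
      intro _
      rw [iteratedDeriv_scaledDenom_line hS μ k₀ _ h' q τ le_rfl, iteratedDeriv_one_slice_line hS h' k₀ q τ,
        norm_mul, Complex.norm_real, Real.norm_of_nonneg h4n.le]
      calc (4 : ℝ) ^ (-h) * ‖fderiv ℝ (fun q => E h' (k₀, q)) q τ‖ ≤ (4 : ℝ) ^ (-h) * (B₃ * (2 : ℝ) ^ h) :=
            mul_le_mul_of_nonneg_left (hgrad h' hh') h4n.le
        _ = B₃ * ((2 : ℝ) ^ h * (4 : ℝ) ^ (-h)) := by ring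
        _ ≤ M * ((2 : ℝ) ^ h * (4 : ℝ) ^ (-h)) := by
            refine mul_le_mul_of_nonneg_right ?_ (by positivity)
            rw [hM]; linarith only [he, hAE0]
    · -- orders `≥ 2` : `(2.42)`
      intro l hl2 hlN
      rw [iteratedDeriv_scaledDenom_line hS μ k₀ _ h' q τ (by omega) 0, norm_mul, Complex.norm_real,
        Real.norm_of_nonneg h4n.le]
      have h1 := norm_iteratedDeriv_dispersion_tangent_le hI hS hh₁ hh₀ hh' hU hUh hk₀ q τ hτ1 N hl2 hlN
      rw [← hSC, ← hAE] at h1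
      refine h1.trans ?_
      rw [h4sq]
      refine mul_le_mul_of_nonneg_right ?_ (by positivity)
      rw [hM]; linarith only [he, hB₃0]
  have hMa : ∀ l ≤ N, ‖iteratedDeriv l a 0‖ ≤ M * ((2 : ℝ) ^ h) ^ min l 2 * ((4 : ℝ) ^ (-h)) ^ l := by
    rw [ha]; exact hprof h (Or.inl rfl) hDa
  have hMb : ∀ l ≤ N, ‖iteratedDeriv l b 0‖ ≤ M * ((2 : ℝ) ^ h) ^ min l 2 * ((4 : ℝ) ^ (-h)) ^ l := by
    rw [hb]; exact hprof (h - 1) (Or.inr rfl) hDb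
  -- the angular factor
  have hnq : c' ≤ ‖momToComplex q‖ := by
    have h1 := lt_sq_add_sq_of_bgmShell_ne_zero hI hS he hh₁ hh₀ hU hUh hK₀ hf
    have h2 : c' ^ 2 ≤ ‖momToComplex q‖ ^ 2 := by rw [norm_momToComplex_sq, hc'sq]; linarith only [h1, hgap']
    exact (pow_le_pow_iff_left₀ hc'0.le (norm_nonneg _) two_ne_zero).1 h2
  have hZb : ∀ l ≤ N, ‖iteratedDeriv l z 0‖ ≤ Z * ((2 : ℝ) ^ h) ^ min l 2 * ((4 : ℝ) ^ (-h)) ^ l := by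
    refine norm_iteratedDeriv_le_twoScale_of_oneScale h2h.le hσ1 h4n.le hZ0 fun l hl => ?_
    rw [hz, hZ]
    exact norm_iteratedDeriv_angular_tangent_le hh₀ (ω : ℤ) N hc'0 hBa0 hBa hnq hτn hl
  exact hK a b z _ _ h2h.le hσ1 h4n.le hac hbc hzc hMa hMb hZb i hi

variable {β U c₀ : ℝ} {C : ℕ → ℝ} {hβ : ℤ} {E : ℤ → ℝ × (Fin 2 → ℝ) → ℂ} {h : ℤ}

/-- Off the support of `F_{h,ω}(k₀(j), ·)` the surrogate integrand vanishes
(`Φ̃ = [f_h · χζ] · inv` and `f_h ζ = F_{h,ω}`). [cite: BenfattoGiulianiMastropietro2006, §2.5 (2.45)–(2.49) p0010:L41–L75] -/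
theorem bgmSurrogateIntegrand_eq_zero_of_bgmSectorFn_eq_zero (e₀ μ r : ℝ) (E : ℤ → ℝ × (Fin 2 → ℝ) → ℂ)
    (h : ℤ) (m : ℕ) (ω : ℤ) {p : ℝ × (Fin 2 → ℝ)} (hF : bgmSectorFn e₀ μ E h m ω p = 0) :
    bgmSurrogateIntegrand μ e₀ r E h m ω p = 0 := by
  by_cases hf : bgmShell e₀ μ E h p = 0
  · have h0 : bgmShellSurrogate e₀ ((((4 : ℝ) ^ (-h) : ℝ) : ℂ) * bgmDenom μ E h p)
        ((((4 : ℝ) ^ (-h) : ℝ) : ℂ) * bgmDenom μ E (h - 1) p) = 0 := by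
      rw [bgmShellSurrogate_eq_bgmShell, hf]
    rw [bgmSurrogateIntegrand, h0]; simp
  · have hζ : sectorWeightCirc m ω (polarAngle p.2) = 0 := by
      have h1 : bgmShell e₀ μ E h p * sectorWeightCirc m ω (polarAngle p.2) = 0 := by
        simpa only [bgmSectorFn] using hF
      exact (mul_eq_zero.1 h1).resolve_left hf
    rw [bgmSurrogateIntegrand]
    simp [hζ]

/-- **(2.55), the export: tangential line derivatives of the surrogate integrand at EVERY point.**  For
`-4 < μ`, `0 < e₀ < μ + 4`, the constants `C` of (2.36), `N` and `c₀` there is `K ≥ 0` such that under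
`E_0 = ε₀`, (2.36a), (2.36) on `h_β ≤ h ≤ 0` with `|U| ≤ c₀`, `|U||h_β| ≤ c₀` and the six coupled smallness
constraints, for every `h_β ≤ h ≤ 0`, `ω`, `j` and every `q⃗` with `|q_i| < 7π/4`, all `i ≤ N`:
`‖∂ₛⁱ Φ̃_{h,n(h),ω}(k₀(j), q⃗ + sτ⃗_h(θ_{n(h),ω}))|₀‖ ≤ K (2^h)^{min(i,2)} (4^{-h})ⁱ`
(`Φ̃ = γ^h F_{h,ω}/D_{h-1}`; on the support by the two-scale device, on its closure by continuity, and
`Φ̃(k₀, ·) ≡ 0` near every other point) — with `N ≥ 2` derivatives this is the `γ^h · γ^{-Nh}` that,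
integrated by parts against the box of volume `γ^{3h/2}` per frequency, yields the term
`γ^{-h}(γ^h|x'₂|)^N` of (2.52). [cite: BenfattoGiulianiMastropietro2006, §2.5 Lemma 2.2 (2.52) and its proof (2.53)–(2.55) p0010:L107–p0011:L22] -/
theorem exists_norm_iteratedDeriv_bgmSurrogateIntegrand_tangent_le (hμ₁ : -4 < μ) (he : 0 < e₀)
    (he4 : e₀ < μ + 4) (C : ℕ → ℝ) (N : ℕ) (c₀ : ℝ) :
    ∃ K : ℝ, 0 ≤ K ∧ ∀ (β U : ℝ) (hβ : ℤ) (E : ℤ → ℝ × (Fin 2 → ℝ) → ℂ),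
      0 < β → BGMInitial E → BGMSymmetry E → BGMSmoothness β U C hβ E → |U| ≤ c₀ → |U| * |(hβ : ℝ)| ≤ c₀ →
      |C 0| * c₀ ≤ 3 / 16 * e₀ → 2 * |C 1| * c₀ ^ 2 ≤ 1 / 2 →
      2 * (4 * |C 2| * c₀ ^ 2) * (2 * |C 0| * c₀ + 2 * e₀) ≤ 1 →
      μ + e₀ + 2 * |C 0| * c₀ < -2 - Real.sqrt 2 → 2 * |C 0| * c₀ ≤ (μ + 4 - e₀) / 2 →
      2 * (2 * |C 1| * c₀ ^ 2) ≤ 2 / π * Real.sqrt ((μ + 4 - e₀) / 2) →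
      ∀ h : ℤ, hβ ≤ h → h ≤ 0 → ∀ (ω : ℕ) (j : ℤ) (q : Fin 2 → ℝ), (∀ i, |q i| < 7 * π / 4) →
      ∀ i ≤ N, ‖iteratedDeriv i (fun s : ℝ =>
        bgmSurrogateIntegrand μ e₀ (Real.sqrt ((μ + 4 - e₀) / 2) / 2) E h (bgmScaleIdx h) ω
          (fermiMatsubara β j, q + s • polarTangent (levelRadius (bgmEffDisp β E h) μ)
            (sectorCenter (bgmScaleIdx h) ω))) 0‖ ≤
        K * ((2 : ℝ) ^ h) ^ min i 2 * ((4 : ℝ) ^ (-h)) ^ i := by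
  have hπ := Real.pi_pos
  obtain ⟨K, hK0, hK⟩ :=
    exists_norm_iteratedDeriv_bgmSurrogateIntegrand_tangent_le_of_support hμ₁ he he4 C N c₀
  refine ⟨K, hK0, ?_⟩
  intro β U hβ E hβpos hI hSy hS hU hUh hK₀ hK₁ hK₂' hgap hgap' hδ₁ h hh₁ hh₀ ω j q hq7 i hi
  have hr : 0 < Real.sqrt ((μ + 4 - e₀) / 2) / 2 := by
    have := Real.sqrt_pos.2 (by linarith : (0 : ℝ) < (μ + 4 - e₀) / 2); positivity
  set r := Real.sqrt ((μ + 4 - e₀) / 2) / 2 with hrdef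
  set n := bgmScaleIdx h with hn
  set τ := polarTangent (levelRadius (bgmEffDisp β E h) μ) (sectorCenter n ω) with hτ
  set k₀ := fermiMatsubara β j with hk₀def
  -- the smooth slice and the line functional
  have hG : ContDiff ℝ i fun q' : Fin 2 → ℝ => bgmSurrogateIntegrand μ e₀ r E h n ω (k₀, q') :=
    contDiff_bgmSurrogateIntegrand_slice hS he hr μ k₀ h n ω
  have hΨ : ∀ q' : Fin 2 → ℝ, iteratedDeriv i (fun s : ℝ => bgmSurrogateIntegrand μ e₀ r E h n ω (k₀, q' + s • τ)) 0 =
      iteratedFDeriv ℝ i (fun q' : Fin 2 → ℝ => bgmSurrogateIntegrand μ e₀ r E h n ω (k₀, q')) q' fun _ => τ := by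
    intro q'
    rw [iteratedDeriv_lineRestriction hG q' τ 0, zero_smul, add_zero]
  set S : Set (Fin 2 → ℝ) :=
    {q' | bgmSectorFn e₀ μ E h n ω (k₀, q') ≠ 0 ∧ q' 0 ^ 2 + q' 1 ^ 2 < (3 * π / 4) ^ 2} with hSdef
  have hRHS : 0 ≤ K * ((2 : ℝ) ^ h) ^ min i 2 * ((4 : ℝ) ^ (-h)) ^ i := by
    have : (0 : ℝ) < (2 : ℝ) ^ h := zpow_pos (by norm_num) _
    have : (0 : ℝ) < (4 : ℝ) ^ (-h) := zpow_pos (by norm_num) _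
    positivity
  by_cases hcl : q ∈ closure S
  · -- on the closure of the support: continuity of `q' ↦ DⁱΦ̃(k₀, q')(τ, …, τ)`
    have hcont : Continuous fun q' : Fin 2 → ℝ =>
        iteratedFDeriv ℝ i (fun q' : Fin 2 → ℝ => bgmSurrogateIntegrand μ e₀ r E h n ω (k₀, q')) q' fun _ => τ :=
      (hG.continuous_iteratedFDeriv le_rfl).eval_const fun _ => τ
    have hclosed : IsClosed {q' : Fin 2 → ℝ |
        ‖iteratedFDeriv ℝ i (fun q' : Fin 2 → ℝ => bgmSurrogateIntegrand μ e₀ r E h n ω (k₀, q')) q' fun _ => τ‖ ≤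
          K * ((2 : ℝ) ^ h) ^ min i 2 * ((4 : ℝ) ^ (-h)) ^ i} :=
      isClosed_le (continuous_norm.comp hcont) continuous_const
    have hsub : S ⊆ {q' : Fin 2 → ℝ |
        ‖iteratedFDeriv ℝ i (fun q' : Fin 2 → ℝ => bgmSurrogateIntegrand μ e₀ r E h n ω (k₀, q')) q' fun _ => τ‖ ≤
          K * ((2 : ℝ) ^ h) ^ min i 2 * ((4 : ℝ) ^ (-h)) ^ i} := by
      intro q' hq'
      have h1 := hK β U hβ E hβpos hI hSy hS hU hUh hK₀ hK₁ hK₂' hgap hgap' hδ₁ h hh₁ hh₀ ω j q' hq'.2 hq'.1 i hi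
      rw [hΨ q'] at h1
      exact h1
    have h1 := closure_minimal hsub hclosed hcl
    rw [hΨ q]
    exact h1
  · -- off the closure: `Φ̃(k₀, ·) ≡ 0` near `q`
    have hW : ∀ᶠ q' in 𝓝 q, q' ∉ S := by
      have ho : IsOpen (closure S)ᶜ := isClosed_closure.isOpen_compl
      filter_upwards [ho.mem_nhds hcl] with q' hq' hS'
      exact hq' (subset_closure hS')
    have h7 : ∀ᶠ q' in 𝓝 q, ∀ l, |q' l| < 7 * π / 4 := by
      refine Filter.eventually_all.2 fun l => ?_
      exact (isOpen_lt (continuous_abs.comp (continuous_apply l)) continuous_const).mem_nhds (hq7 l)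
    have hzero : ∀ᶠ q' in 𝓝 q, bgmSurrogateIntegrand μ e₀ r E h n ω (k₀, q') = 0 := by
      filter_upwards [hW, h7] with q' hq'S hq'7
      have hF0 : bgmSectorFn e₀ μ E h n ω (k₀, q') = 0 := by
        by_contra hF'
        have hf' : bgmShell e₀ μ E h (k₀, q') ≠ 0 := left_ne_zero_of_mul hF'
        have hball := sq_add_sq_lt_of_bgmShell_ne_zero hI hS he hh₁ hh₀ hU hUh hμ₁ hK₀ hgap hq'7 hf'
        exact hq'S ⟨hF', hball.trans sq_pi_div_four_lt_tb⟩
      exact bgmSurrogateIntegrand_eq_zero_of_bgmSectorFn_eq_zero e₀ μ r E h n ω hF0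
    have hline : Tendsto (fun s : ℝ => q + s • τ) (𝓝 0) (𝓝 q) :=
      ((by fun_prop : Continuous fun s : ℝ => q + s • τ).tendsto' 0 q (by simp))
    have hev : (fun s : ℝ => bgmSurrogateIntegrand μ e₀ r E h n ω (k₀, q + s • τ)) =ᶠ[𝓝 0] fun _ => (0 : ℂ) :=
      hline.eventually hzero
    rw [hev.iteratedDeriv_eq, iteratedDeriv_const]
    simp only [ite_self, norm_zero]
    exact hRHS

/-- **(2.55) for the true integrand `F_{h,ω}/D_{h-1}`** (`= γ^{-h}Φ̃` pointwise, the radial plateau being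
`1` on the support of `f_h`): the same bound with the extra factor `γ^{-h} = 4^{-h}` of `1/D_{h-1}` —
`‖∂ₛⁱ[F_{h,ω}/D_{h-1}](k₀(j), q⃗ + sτ⃗)|₀‖ ≤ K 4^{-h} (2^h)^{min(i,2)} (4^{-h})ⁱ`, i.e. `Kγ^{-ih}` for
`i ≥ 2`: BGM's "`∂^N_{k'₂}[F_{h,ω}(k)/(-ik₀ + E_{h-1}(k) - μ)] = O(γ^{-Nh})`, `N ≥ 2`".
[cite: BenfattoGiulianiMastropietro2006, §2.5 proof of Lemma 2.2 (2.55) p0011:L17–L22] -/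
theorem exists_norm_iteratedDeriv_sectorIntegrand_tangent_le (hμ₁ : -4 < μ) (he : 0 < e₀)
    (he4 : e₀ < μ + 4) (C : ℕ → ℝ) (N : ℕ) (c₀ : ℝ) :
    ∃ K : ℝ, 0 ≤ K ∧ ∀ (β U : ℝ) (hβ : ℤ) (E : ℤ → ℝ × (Fin 2 → ℝ) → ℂ),
      0 < β → BGMInitial E → BGMSymmetry E → BGMSmoothness β U C hβ E → |U| ≤ c₀ → |U| * |(hβ : ℝ)| ≤ c₀ →
      |C 0| * c₀ ≤ 3 / 16 * e₀ → 2 * |C 1| * c₀ ^ 2 ≤ 1 / 2 →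
      2 * (4 * |C 2| * c₀ ^ 2) * (2 * |C 0| * c₀ + 2 * e₀) ≤ 1 →
      μ + e₀ + 2 * |C 0| * c₀ < -2 - Real.sqrt 2 → 2 * |C 0| * c₀ ≤ (μ + 4 - e₀) / 2 →
      2 * (2 * |C 1| * c₀ ^ 2) ≤ 2 / π * Real.sqrt ((μ + 4 - e₀) / 2) →
      ∀ h : ℤ, hβ ≤ h → h ≤ 0 → ∀ (ω : ℕ) (j : ℤ) (q : Fin 2 → ℝ), (∀ i, |q i| < 7 * π / 4) →
      ∀ i ≤ N, ‖iteratedDeriv i (fun s : ℝ =>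
        ((bgmSectorFn e₀ μ E h (bgmScaleIdx h) ω
            (fermiMatsubara β j, q + s • polarTangent (levelRadius (bgmEffDisp β E h) μ)
              (sectorCenter (bgmScaleIdx h) ω)) : ℝ) : ℂ) /
          bgmDenom μ E (h - 1)
            (fermiMatsubara β j, q + s • polarTangent (levelRadius (bgmEffDisp β E h) μ)
              (sectorCenter (bgmScaleIdx h) ω))) 0‖ ≤
        K * (4 : ℝ) ^ (-h) * ((2 : ℝ) ^ h) ^ min i 2 * ((4 : ℝ) ^ (-h)) ^ i := by
  obtain ⟨K, hK0, hK⟩ := exists_norm_iteratedDeriv_bgmSurrogateIntegrand_tangent_le hμ₁ he he4 C N c₀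
  refine ⟨K, hK0, ?_⟩
  intro β U hβ E hβpos hI hSy hS hU hUh hK₀ hK₁ hK₂' hgap hgap' hδ₁ h hh₁ hh₀ ω j q hq7 i hi
  have hr : 0 < Real.sqrt ((μ + 4 - e₀) / 2) / 2 := by
    have := Real.sqrt_pos.2 (by linarith : (0 : ℝ) < (μ + 4 - e₀) / 2); positivity
  have hc'sq : Real.sqrt ((μ + 4 - e₀) / 2) ^ 2 = (μ + 4 - e₀) / 2 := Real.sq_sqrt (by linarith)
  set r := Real.sqrt ((μ + 4 - e₀) / 2) / 2 with hrdef
  set n := bgmScaleIdx h with hn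
  set τ := polarTangent (levelRadius (bgmEffDisp β E h) μ) (sectorCenter n ω) with hτ
  set k₀ := fermiMatsubara β j with hk₀def
  have hk₀ : k₀ ∈ matsubaraSet β := ⟨j, rfl⟩
  have h4n : (0 : ℝ) < (4 : ℝ) ^ (-h) := zpow_pos (by norm_num) _
  -- `F/D = γ^{-h} Φ̃` along the line (every point)
  have hfun : (fun s : ℝ => ((bgmSectorFn e₀ μ E h n ω (k₀, q + s • τ) : ℝ) : ℂ) /
      bgmDenom μ E (h - 1) (k₀, q + s • τ)) =
      fun s => (((4 : ℝ) ^ (-h) : ℝ) : ℂ) * bgmSurrogateIntegrand μ e₀ r E h n ω (k₀, q + s • τ) := by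
    funext s
    have hη := norm_E_sub_E_le_threshold hS hh₁ hh₀ hUh hK₀ hk₀ (q + s • τ)
    refine sectorIntegrand_eq_bgmSurrogateIntegrand hr he hη n ω fun hf => ?_
    have h1 := lt_sq_add_sq_of_bgmShell_ne_zero hI hS he hh₁ hh₀ hU hUh hK₀ hf
    have h2 : (2 * r) ^ 2 ≤ ‖momToComplex (q + s • τ)‖ ^ 2 := by
      rw [norm_momToComplex_sq, show 2 * r = Real.sqrt ((μ + 4 - e₀) / 2) by rw [hrdef]; ring, hc'sq]
      linarith
    have h3 : 2 * r ≤ ‖momToComplex (q + s • τ)‖ :=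
      (pow_le_pow_iff_left₀ (by positivity) (norm_nonneg _) two_ne_zero).1 h2
    show r ≤ ‖momToComplex (k₀, q + s • τ).2‖
    linarith
  rw [hfun]
  have hG : ContDiff ℝ i fun q' : Fin 2 → ℝ => bgmSurrogateIntegrand μ e₀ r E h n ω (k₀, q') :=
    contDiff_bgmSurrogateIntegrand_slice hS he hr μ k₀ h n ω
  have hl := contDiff_lineRestriction hG q τ
  rw [iteratedDeriv_const_mul _ hl.contDiffAt, norm_mul, Complex.norm_real, Real.norm_of_nonneg h4n.le]
  have h1 := hK β U hβ E hβpos hI hSy hS hU hUh hK₀ hK₁ hK₂' hgap hgap' hδ₁ h hh₁ hh₀ ω j q hq7 i hi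
  calc (4 : ℝ) ^ (-h) * ‖iteratedDeriv i (fun s : ℝ => bgmSurrogateIntegrand μ e₀ r E h n ω (k₀, q + s • τ)) 0‖
      ≤ (4 : ℝ) ^ (-h) * (K * ((2 : ℝ) ^ h) ^ min i 2 * ((4 : ℝ) ^ (-h)) ^ i) := mul_le_mul_of_nonneg_left h1 h4n.le
    _ = _ := by ring

end Export

end Literature.MathematicalPhysics.QuantumLattice.FermiRG
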